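import Summits.NavierStokesRegularity.FunctionalMining.StretchingLaminateRecord3E
import Summits.NavierStokesRegularity.FunctionalMining.StretchingLaminateConst
import Summits.NavierStokesRegularity.FunctionalMining.StretchingLaminateStepRealization
import HarnessLib

/-!
# K1-Q1 laminates: record tree certificate — `0.6752 ≤ C_lam`; `0.6752 ≤ C⋆` given `LaminateStep`

Dict seat, staged 2026-08-20T14:11Z. NS FUNCTIONAL MINING cell (`pub-nsfunc`), dictionary seat gen 11 — **search for
candidate a priori estimates; no regularity claim.** STATIC field
inequalities only: nothing about Navier–Stokes solutions is asserted anywhere in this file.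

THE TYPED RECORD of the laminate ladder: the kernel certificate of the bank's 800-split tree `treeE800`
(`StretchingLaminateRecord3A`–`E`, source `pub-nsfunc-bank/tools/lam/runs/d3l65_800_exactE.json` 661fd740bf3f69aa):
* `treeE800_cert : treeE800.cert (422/625) = true` — `decide +kernel` (exact rational arithmetic on the 800 splits:
  validity of every split `0 < λ < 1`, `c·n = 0`, and `σ² ≥ r²·M²·E²` with `σ > 0`; σ and E are rationals with
  several thousand digits);
* `e800_le_laminateSupConst : 422/625 ≤ C_lam` — UNCONDITIONAL (the laminate constant of `StretchingLaminateConst`);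
* `laminate_e800_le_stretchingSupConst : LaminateRealization → 422/625 ≤ C⋆` and
  `e800_le_stretchingSupConst_of_step : LaminateStep → 422/625 ≤ C⋆` (via `laminateRealization_of_step` of
  `StretchingLaminateStepRealization`) — the field-level bound hangs on the one analytic node `LaminateStep`
  exactly like the rungs 0.552 / 0.6395 / 0.6583 / 0.6719 already in the tree; it supersedes the typed record
  `6719/10000` (`StretchingLaminateRecord2`) by `33/10000`.
HONEST SIZE. A certificate of ONE explicit laminate; the laminate METHOD is capped in the kernel
(`laminateSupConst_le_nine_eighths`, and sharper caps) strictly below `2/√3`, and the paper-level cap of the method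
is
`0.91` (bank THEOREM L-CAP-B, two-party exact certificate) — so this rung is within `0.235` of the best the method
can
give and says nothing about the VALUE of `C⋆` beyond the lower bound. Unconditionally the tree has
`(2+√5)/8 ≤ C⋆ < 2/√3`. search for candidate a priori estimates; no regularity claim. [ours]
-/

namespace Summit.NavierStokesRegularity.FunctionalMining

namespace Laminate

/-- **Kernel certificate of the record tree**: `treeE800.cert (422/625) = true` (exact rational arithmetic by
`decide +kernel`). [ours; computation] -/
theorem treeE800_cert : treeE800.cert (422 / 625) = true := by decide +kernel

/-- The typed record beats the previous typed record `6719/10000` (`StretchingLaminateRecord2`). [ours; bookkeeping]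
-/
theorem d3g1_lt_e800 : (6719 / 10000 : ℝ) < 422 / 625 := by norm_num

/-- **`422/625 = 0.6752 ≤ C_lam` UNCONDITIONALLY** (the laminate constant). search for candidate a priori estimates;
no regularity claim. [ours] -/
theorem e800_le_laminateSupConst : (422 / 625 : ℝ) ≤ laminateSupConst := by
  have h := le_laminateSupConst_of_cert treeE800 (422 / 625) treeE800_cert
  push_cast at h
  exact h

/-- **`LaminateRealization → 0.6752 ≤ C⋆`.** search for candidate a priori estimates; no regularity claim. [ours] -/
theorem laminate_e800_le_stretchingSupConst (h : LaminateRealization) :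
    (422 / 625 : ℝ) ≤ stretchingSupConst (d := Fin 3) := by
  have := le_stretchingSupConst_of_cert h treeE800 (422 / 625) treeE800_cert
  norm_num at this
  exact this

/-- **`LaminateStep → 0.6752 ≤ C⋆`** (the field-level record rung, conditional on the one analytic node exactly like
`d4_le_stretchingSupConst_of_step`). search for candidate a priori estimates; no regularity claim. [ours] -/
theorem e800_le_stretchingSupConst_of_step (hstep : LaminateStep) :
    (422 / 625 : ℝ) ≤ stretchingSupConst (d := Fin 3) :=
  laminate_e800_le_stretchingSupConst (laminateRealization_of_step hstep)

end Laminate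

end Summit.NavierStokesRegularity.FunctionalMining
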